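import Literature.NumberTheory.SerreUniformity.SplitCartan
import Literature.NumberTheory.EllipticCurves.BalakrishnanEtAl2019.SplitCartanImages
import Literature.NumberTheory.EllipticCurves.SerreOpenImageNormalizerCaseProofs
import Literature.NumberTheory.GaloisRepresentations.SerreCartanNormalizerGL2Fp
import HarnessLib

/-!
# The two tree renderings of "image in the normaliser of a split Cartan subgroup" are
# EQUIVALENT: `SerreUniformity/SplitCartan.lean` (explicit diagonal/antidiagonal matrices in a
# basis) ⟺ `BalakrishnanEtAl2019/SplitCartanImages.lean` (frames and `N(P (* 0; 0 *) P⁻¹)`)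

`Proofs` file (theorems only; no definition, no named fact), topic
`Literature/NumberTheory/SerreUniformity`.  The published theorem BDMTV 2019 Thm. 1.2 ("only if"
half) / Bilu–Parent–Rebolledo 2013 Cor. 1.2 is vendored TWICE in the tree, in two vocabularies:

* `Literature.NumberTheory.EllipticCurves.BalakrishnanEtAl2019.thm12_not_le_normalizer_splitCartan`
  (x9 seat, 2026-08-18): for every frame `(e, Φ)` of `E[p]` and every `P ∈ GL₂(𝔽_p)`,
  `Φ(ρ̄_{E,p}(Γ_ℚ)) ⊄ N(P (* 0; 0 *) P⁻¹)` (non-CM `E/ℚ`, `p > 7`);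
* `Literature.NumberTheory.SerreUniformity.BDMTV2019_splitCartanPointsAreCM` (x11c seat,
  2026-08-20, filed before the first was noticed): for `p > 7`, an `E/ℚ` with a basis of `E[p]` in
  which every `σ ∈ Γ_ℚ` acts by an invertible diagonal or antidiagonal matrix has CM.

This file proves the dictionary between the two vocabularies (Bilu–Parent–Rebolledo §1: the
normaliser of a split Cartan subgroup is, up to conjugacy, "the subgroup of diagonal and
anti-diagonal elements") and hence that the two named facts are EQUIVALENT statements
(`BDMTV2019_splitCartanPointsAreCM_iff_thm12`), so that they count as ONE vendored theorem:
either is discharged from the other (`splitCartanPointsAreCM_of_thm12`,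
`thm12_of_splitCartanPointsAreCM`).

* `hasSplitCartanNormalizerModPImage_of_le_normalizer_splitCartan` — frame `(e, Φ)` and `P` with
  `Φ(ρ̄(Γ_ℚ)) ≤ N(P (* 0; 0 *) P⁻¹)` ⟹ the explicit predicate (basis `x ↦ P⁻¹ · e x`; Serre 1972
  §2.2: `N ∖ C` swaps the two lines, `mem_normalizer_splitCartan_iff`).
* `exists_le_normalizer_splitCartan_of_hasSplitCartanNormalizerModPImage` — the explicit
  predicate ⟹ for EVERY frame `(e₀, Φ)` some `P` with `Φ(ρ̄(Γ_ℚ)) ≤ N(P (* 0; 0 *) P⁻¹)` (the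
  change of basis `e ∘ e₀⁻¹` is an invertible matrix `Q`; `P = Q⁻¹`).

## References

* [BalakrishnanEtAl2019] Balakrishnan–Dogra–Müller–Tuitman–Vonk, Ann. of Math. 189 (2019), §1 Thm. 1.2.
* [BiluParentRebolledo2013] Bilu–Parent–Rebolledo, Ann. Inst. Fourier 63 (2013), §1, Cor. 1.2
  and the paragraph "the subgroup of diagonal and anti-diagonal elements".
* [SerreInventiones1972] J.-P. Serre, Invent. Math. 15 (1972), §2.2.
-/

noncomputable section

open scoped Classical MatrixGroups
open Matrix Field WeierstrassCurve
open Literature.NumberTheory.EllipticCurves Literature.NumberTheory.GaloisRepresentations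
  Literature.NumberTheory.GaloisRepresentations.Serre1972
  Literature.NumberTheory.EllipticCurves.BalakrishnanEtAl2019

namespace Literature.NumberTheory.SerreUniformity

variable {p : ℕ} [hp : Fact p.Prime]

/-- An additive automorphism `f` of `𝔽_p²` is `v ↦ Q v` for an invertible matrix `Q` (additive
maps of `𝔽_p`-vector spaces are linear). Private plumbing. [folklore] -/
private theorem exists_units_mulVec_eq (f : (Fin 2 → ZMod p) ≃+ (Fin 2 → ZMod p)) :
    ∃ Q : GL (Fin 2) (ZMod p), ∀ v : Fin 2 → ZMod p,
      ((Q : GL (Fin 2) (ZMod p)) : Matrix (Fin 2) (Fin 2) (ZMod p)) *ᵥ v = f v := by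
  let fL : (Fin 2 → ZMod p) →ₗ[ZMod p] (Fin 2 → ZMod p) := f.toAddMonoidHom.toZModLinearMap p
  let gL : (Fin 2 → ZMod p) →ₗ[ZMod p] (Fin 2 → ZMod p) := f.symm.toAddMonoidHom.toZModLinearMap p
  have hfL : ∀ v, fL v = f v := fun v ↦ rfl
  have hgL : ∀ v, gL v = f.symm v := fun v ↦ rfl
  have hfg : fL.comp gL = LinearMap.id := LinearMap.ext fun v ↦ by simp [hfL, hgL]
  have hgf : gL.comp fL = LinearMap.id := LinearMap.ext fun v ↦ by simp [hfL, hgL]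
  refine ⟨⟨LinearMap.toMatrix' fL, LinearMap.toMatrix' gL, ?_, ?_⟩, fun v ↦ ?_⟩
  · rw [← LinearMap.toMatrix'_comp, hfg, LinearMap.toMatrix'_id]
  · rw [← LinearMap.toMatrix'_comp, hgf, LinearMap.toMatrix'_id]
  · show LinearMap.toMatrix' fL *ᵥ v = f v
    rw [← Matrix.toLin'_apply, Matrix.toLin'_toMatrix', hfL]

/-! ### Frame statement ⟹ explicit predicate -/

/-- **Dictionary, first half.**  If in a frame `(e, Φ)` of `E[p]` the image `Φ(ρ̄_{W,p}(Γ_F))`...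
(here `F = ℚ`) is contained in the normaliser of the split Cartan subgroup `P (* 0; 0 *) P⁻¹`, then
in the basis `x ↦ P⁻¹ · e x` every `σ` acts through an invertible diagonal or antidiagonal matrix:
`HasSplitCartanNormalizerModPImage W p` (Serre 1972 §2.2, `mem_normalizer_splitCartan_iff`, `p ≠ 2`).
[cite: BiluParentRebolledo2013, §1 (the subgroup of diagonal and anti-diagonal elements)]
[cite: SerreInventiones1972, §2.2] -/
theorem hasSplitCartanNormalizerModPImage_of_le_normalizer_splitCartan (hp2 : p ≠ 2)
    (W : WeierstrassCurve ℚ)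
    (Φ : Multiplicative (AddAut (geomTorsion W p)) ≃* GL (Fin 2) (ZMod p))
    (e : geomTorsion W p ≃+ (Fin 2 → ZMod p))
    (he : ∀ (g : Multiplicative (AddAut (geomTorsion W p))) (x : geomTorsion W p),
      e (Multiplicative.toAdd g x) =
        ((Φ g : GL (Fin 2) (ZMod p)) : Matrix (Fin 2) (Fin 2) (ZMod p)) *ᵥ e x)
    {P : GL (Fin 2) (ZMod p)}
    (hle : (galoisRepTorsion W p).range.map Φ.toMonoidHom ≤
      Subgroup.normalizer (splitCartan P : Set (GL (Fin 2) (ZMod p)))) :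
    HasSplitCartanNormalizerModPImage W p := by
  have hF : ∃ u : (ZMod p)ˣ, u ≠ 1 := exists_units_ne_one hp2
  have hPinv : ((P : GL (Fin 2) (ZMod p)) : Matrix (Fin 2) (Fin 2) (ZMod p)) *
      ((P⁻¹ : GL (Fin 2) (ZMod p)) : Matrix (Fin 2) (Fin 2) (ZMod p)) = 1 := by
    rw [← Units.val_mul, mul_inv_cancel, Units.val_one]
  have hinvP : ((P⁻¹ : GL (Fin 2) (ZMod p)) : Matrix (Fin 2) (Fin 2) (ZMod p)) *
      ((P : GL (Fin 2) (ZMod p)) : Matrix (Fin 2) (Fin 2) (ZMod p)) = 1 := by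
    rw [← Units.val_mul, inv_mul_cancel, Units.val_one]
  let Q : (Fin 2 → ZMod p) ≃+ (Fin 2 → ZMod p) :=
    { toFun := fun v ↦ ((P⁻¹ : GL (Fin 2) (ZMod p)) : Matrix (Fin 2) (Fin 2) (ZMod p)) *ᵥ v
      invFun := fun v ↦ ((P : GL (Fin 2) (ZMod p)) : Matrix (Fin 2) (Fin 2) (ZMod p)) *ᵥ v
      left_inv := fun v ↦ by
        simp only [Matrix.mulVec_mulVec, hPinv, Matrix.one_mulVec]
      right_inv := fun v ↦ by
        simp only [Matrix.mulVec_mulVec, hinvP, Matrix.one_mulVec]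
      map_add' := fun v w ↦ Matrix.mulVec_add _ _ _ }
  have hQ : ∀ v, Q v = ((P⁻¹ : GL (Fin 2) (ZMod p)) : Matrix (Fin 2) (Fin 2) (ZMod p)) *ᵥ v :=
    fun v ↦ rfl
  refine ⟨e.trans Q, fun σ ↦ ?_⟩
  have hmem := (mem_normalizer_splitCartan_iff hF).mp
    (hle (apply_galoisRepTorsion_mem_map_range W p Φ σ))
  refine ⟨((P⁻¹ * Φ (galoisRepTorsion W p σ) * P : GL (Fin 2) (ZMod p)) :
      Matrix (Fin 2) (Fin 2) (ZMod p)), ⟨GL2.det_ne_zero _, ?_⟩, fun x ↦ ?_⟩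
  · rcases hmem with h | h
    · exact Or.inl h
    · exact Or.inr h
  · rw [AddEquiv.trans_apply, AddEquiv.trans_apply, hQ, hQ, ← galoisRepTorsion_apply W p σ x,
      he (galoisRepTorsion W p σ) x, Units.val_mul, Units.val_mul, Matrix.mulVec_mulVec,
      Matrix.mulVec_mulVec, Matrix.mul_assoc, Matrix.mul_assoc, hPinv, Matrix.mul_one]

/-! ### Explicit predicate ⟹ frame statement (for every frame) -/

/-- **Dictionary, second half.**  If in some basis `e` of `E[p]` every `σ ∈ Γ_ℚ` acts through an
invertible diagonal or antidiagonal matrix, then for EVERY frame `(e₀, Φ)` of `E[p]` there is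
`P ∈ GL₂(𝔽_p)` with `Φ(ρ̄_{W,p}(Γ_ℚ)) ≤ N(P (* 0; 0 *) P⁻¹)`: take `P = Q⁻¹` where `Q` is the matrix
of the change of basis `e ∘ e₀⁻¹`, so that `P⁻¹ Φ(ρ̄ σ) P = Q Φ(ρ̄ σ) Q⁻¹` is the matrix of `σ` in the
basis `e`. (`p ≠ 2`.) [cite: BiluParentRebolledo2013, §1 (the subgroup of diagonal and anti-diagonal elements)]
[cite: SerreInventiones1972, §2.2] -/
theorem exists_le_normalizer_splitCartan_of_hasSplitCartanNormalizerModPImage (hp2 : p ≠ 2)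
    (W : WeierstrassCurve ℚ) (himg : HasSplitCartanNormalizerModPImage W p)
    (Φ : Multiplicative (AddAut (geomTorsion W p)) ≃* GL (Fin 2) (ZMod p))
    (e₀ : geomTorsion W p ≃+ (Fin 2 → ZMod p))
    (he₀ : ∀ (g : Multiplicative (AddAut (geomTorsion W p))) (x : geomTorsion W p),
      e₀ (Multiplicative.toAdd g x) =
        ((Φ g : GL (Fin 2) (ZMod p)) : Matrix (Fin 2) (Fin 2) (ZMod p)) *ᵥ e₀ x) :
    ∃ P : GL (Fin 2) (ZMod p),
      (galoisRepTorsion W p).range.map Φ.toMonoidHom ≤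
        Subgroup.normalizer (splitCartan P : Set (GL (Fin 2) (ZMod p))) := by
  have hF : ∃ u : (ZMod p)ˣ, u ≠ 1 := exists_units_ne_one hp2
  obtain ⟨e, hσ⟩ := himg
  obtain ⟨Q, hQ⟩ := exists_units_mulVec_eq (e₀.symm.trans e)
  -- `Q (e₀ x) = e x`, so `Q⁻¹ (e x) = e₀ x`
  have hQe : ∀ x : geomTorsion W p,
      ((Q : GL (Fin 2) (ZMod p)) : Matrix (Fin 2) (Fin 2) (ZMod p)) *ᵥ e₀ x = e x := fun x ↦ by
    rw [hQ, AddEquiv.trans_apply, AddEquiv.symm_apply_apply]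
  have hinvQ : ((Q⁻¹ : GL (Fin 2) (ZMod p)) : Matrix (Fin 2) (Fin 2) (ZMod p)) *
      ((Q : GL (Fin 2) (ZMod p)) : Matrix (Fin 2) (Fin 2) (ZMod p)) = 1 := by
    rw [← Units.val_mul, inv_mul_cancel, Units.val_one]
  have hQe' : ∀ x : geomTorsion W p,
      ((Q⁻¹ : GL (Fin 2) (ZMod p)) : Matrix (Fin 2) (Fin 2) (ZMod p)) *ᵥ e x = e₀ x := fun x ↦ by
    rw [← hQe, Matrix.mulVec_mulVec, hinvQ, Matrix.one_mulVec]
  refine ⟨Q⁻¹, fun g hg ↦ ?_⟩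
  obtain ⟨σ, rfl⟩ := (mem_map_range_galoisRepTorsion_iff W p Φ).mp hg
  obtain ⟨M, ⟨-, hshape⟩, hM⟩ := hσ σ
  -- the conjugate `Q Φ(ρ̄ σ) Q⁻¹` is the matrix `M` of `σ` in the basis `e`
  have key : ((Q⁻¹⁻¹ * Φ (galoisRepTorsion W p σ) * Q⁻¹ : GL (Fin 2) (ZMod p)) :
      Matrix (Fin 2) (Fin 2) (ZMod p)) = M := by
    rw [inv_inv]
    have hv : ∀ v : Fin 2 → ZMod p,
        (((Q * Φ (galoisRepTorsion W p σ) * Q⁻¹ : GL (Fin 2) (ZMod p)) :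
          Matrix (Fin 2) (Fin 2) (ZMod p))) *ᵥ v = M *ᵥ v := fun v ↦ by
      obtain ⟨x, rfl⟩ := e.surjective v
      rw [Units.val_mul, Units.val_mul, ← Matrix.mulVec_mulVec, ← Matrix.mulVec_mulVec, hQe',
        ← he₀ (galoisRepTorsion W p σ) x, galoisRepTorsion_apply W p σ x, hQe, hM]
    exact Matrix.mulVec_injective (funext hv)
  rw [mem_normalizer_splitCartan_iff hF, key]
  rcases hshape with h | h
  · exact Or.inl h
  · exact Or.inr h

/-! ### The two named facts are equivalent -/

/-- **BDMTV 2019 Thm. 1.2 in the explicit-matrix language FROM the frame language**: the x9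
seat's named fact `thm12_not_le_normalizer_splitCartan` implies `BDMTV2019_splitCartanPointsAreCM`
(so the latter is NOT an independent vendored assumption). [cite: BalakrishnanEtAl2019, §1 Thm. 1.2 (arXiv:1711.05846 p. 2)] -/
theorem splitCartanPointsAreCM_of_thm12 (hB : thm12_not_le_normalizer_splitCartan) :
    BDMTV2019_splitCartanPointsAreCM := by
  intro q hq h7 W _ himg
  haveI : Fact q.Prime := ⟨hq⟩
  by_contra hCM
  obtain ⟨e₀, Φ, he₀, -⟩ := exists_frame_galoisRepTorsion_rat W q
  obtain ⟨P, hP⟩ := exists_le_normalizer_splitCartan_of_hasSplitCartanNormalizerModPImage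
    (by omega) W himg Φ e₀ he₀
  exact hB W q hCM h7 Φ e₀ he₀ P hP

/-- **… and conversely**: `BDMTV2019_splitCartanPointsAreCM` implies the frame-language fact
`thm12_not_le_normalizer_splitCartan`. [cite: BalakrishnanEtAl2019, §1 Thm. 1.2 (arXiv:1711.05846 p. 2)] -/
theorem thm12_of_splitCartanPointsAreCM (hS : BDMTV2019_splitCartanPointsAreCM) :
    thm12_not_le_normalizer_splitCartan := by
  intro W _ q _ hCM h7 Φ e he P hle
  exact hCM (hS q Fact.out h7 W
    (hasSplitCartanNormalizerModPImage_of_le_normalizer_splitCartan (by omega) W Φ e he hle))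

/-- **The two tree renderings of BDMTV 2019 Thm. 1.2 ("only if" half) are EQUIVALENT** — they are
one vendored theorem, not two. [cite: BalakrishnanEtAl2019, §1 Thm. 1.2 (arXiv:1711.05846 p. 2)]
[cite: BiluParentRebolledo2013, Cor. 1.2] -/
theorem BDMTV2019_splitCartanPointsAreCM_iff_thm12 :
    BDMTV2019_splitCartanPointsAreCM ↔ thm12_not_le_normalizer_splitCartan :=
  ⟨thm12_of_splitCartanPointsAreCM, splitCartanPointsAreCM_of_thm12⟩

end Literature.NumberTheory.SerreUniformity

end
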